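import Mathlib
import Summits.Ventures.HodgeRepro2.T5DualPairLatticeKronecker
import Summits.Ventures.HodgeRepro2.T5QuadraticTrace

/-!
# THE DUAL-PAIR LATTICE FOR THE SYMPLECTIC TRACE FORM OF FILE 90

Tier-5 support N3 / §G-N4.2 (seat p3, gen 85). File 341 stated the self-duality of `L_V ⊗ L_W = 𝒪_w^{ι × κ}` for
the Kronecker Gram matrix with p8's `T5UnitaryGroupIsometry.sesqForm J x y = star x ⬝ᵥ (J *ᵥ y)`; file 90's
coordinate model of the symplectic space `V ⊗_E W` uses `gram M x y = star x ⬝ᵥ (M *ᵥ y)` and the symplectic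
trace form `traceGram K z z' = gram K z z' + star (gram K z z')`. This file identifies the two spellings and
reads the record statement on the symplectic form:

* **`gram_eq_sesqForm`** — `gram M x y = sesqForm M x y` (the same function; `rfl`);
* **`forall_recordChar_gram_kronecker_iff_mem_stdLattice`** — file 341's record statement in file 90's spelling:
  `(∀ y ∈ 𝒪_w^{ι × κ}, ψ_w(gram (M_V ⊗ₖ M_W) x y) = 1) ⟺ x ∈ 𝒪_w^{ι × κ}` outside `disc K`;
* **`algebraMap_trace_gram_eq_traceGram`** — when `star` is the conjugation of a quadratic Galois extension
  `E/F` (`[E : F] = 2`, `star` fixing `F`, `star ≠ id`), `Tr_{E/F}(gram K z z') = traceGram K z z'` (file 94's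
  `algebraMap_trace_eq_add_star`, file 90's `traceGram_apply`); **`recordChar_gram_eq`** — `ψ_w(gram K z z')` is
  `ψ(Tr_{K⁺_v/ℚ_p}(Tr_{K_w/K⁺_v}(gram K z z')))`; **`algebraMap_trace_gram_eq_traceGram_adicCompletion`** — on
  the record's `K_w / K⁺_v` with `star = σ`: the inner trace of `gram` IS `traceGram`, file 90's symplectic form.
  So the self-duality of file 341 is the self-duality of `L_V ⊗ L_W` for the symplectic form `Tr_{E/F}(h ⊗ s)` of
  the dual pair and the character `ψ ∘ Tr_{K⁺_v/ℚ_p}` of `F = K⁺_v` — MVW Chapter 5's «`L ⊂ W` autodual» literally.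

Nothing here is a statement about (P), theta lifts or L-values. §8(d): uses an L-value-free non-vanishing
device: NO.
-/

open IsDedekindDomain IsDedekindDomain.HeightOneSpectrum NumberField Matrix
open scoped Kronecker
open Summit.Ventures.HodgeRepro2.T5AdditiveConductor Summit.Ventures.HodgeRepro2.T5UnitaryGroupIsometry
  Summit.Ventures.HodgeRepro2.T5ConductorDualLattice Summit.Ventures.HodgeRepro2.T5GlobalLatticeAlmostAll
  Summit.Ventures.HodgeRepro2.T5IntegralGramBadSet Summit.Ventures.HodgeRepro2.T5DualPairLatticeKronecker
  Summit.Ventures.HodgeRepro2.T5DeltaTwistTensor Summit.Ventures.HodgeRepro2.T5QuadraticTrace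

namespace Summit.Ventures.HodgeRepro2.T5DualPairLatticeSymplectic

section Gram

variable {E : Type*} [Field E] [StarRing E] {ι : Type*} [Fintype ι]

/-- **File 90's `gram` is p8's `sesqForm`**: both are `star x ⬝ᵥ (M *ᵥ y)`. -/
theorem gram_eq_sesqForm (M : Matrix ι ι E) (x y : ι → E) : gram M x y = sesqForm M x y := rfl

end Gram

section Record

variable (K : Type*) [Field K] [NumberField K]
variable {ι κ : Type*} [Fintype ι] [DecidableEq ι] [Fintype κ] [DecidableEq κ]
variable (MV : Matrix ι ι (𝓞 K)) (hV : IsUnit MV.det) (MW : Matrix κ κ (𝓞 K)) (hW : IsUnit MW.det)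
variable (vp : HeightOneSpectrum (𝓞 ℚ)) (v : HeightOneSpectrum (𝓞 (maximalRealSubfield K)))
  [v.asIdeal.LiesOver vp.asIdeal] (w : HeightOneSpectrum (𝓞 K)) [w.asIdeal.LiesOver v.asIdeal]

include hV hW in
/-- **THE DUAL-PAIR LATTICE IN FILE 90's SPELLING**: outside `disc K`, for integral unimodular `M_V`, `M_W`,
`(∀ y ∈ 𝒪_w^{ι × κ}, ψ_w(gram (M_V ⊗ₖ M_W) x y) = 1) ⟺ x ∈ 𝒪_w^{ι × κ}` with `ψ_w = ψ ∘ Tr_{K⁺_v/ℚ_p} ∘ Tr_{K_w/K⁺_v}`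
(file 341's `forall_recordChar_kronecker_iff_mem_stdLattice`, `gram = sesqForm`). -/
theorem forall_recordChar_gram_kronecker_iff_mem_stdLattice
    (h : ((discr K : ℤ) : 𝓞 (maximalRealSubfield K)) ∉ v.asIdeal)
    (ψ : AddChar (vp.adicCompletion ℚ) Circle) (hψ : Continuous ψ) (hne : ∃ y, ψ y ≠ 1)
    (h0 : conductorExp ψ (Valued.v : Valuation (vp.adicCompletion ℚ) (WithZero (Multiplicative ℤ))) = 0)
    [StarRing (w.adicCompletion K)]
    (hstar : ∀ z : w.adicCompletion K, IsLocalization.IsInteger (w.adicCompletionIntegers K) z →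
      IsLocalization.IsInteger (w.adicCompletionIntegers K) (star z))
    (x : ι × κ → w.adicCompletion K) :
    (∀ y ∈ stdLattice (w.adicCompletionIntegers K),
      recordChar K vp v w ψ
        (gram (((algebraMap (𝓞 K) K).mapMatrix MV ⊗ₖ (algebraMap (𝓞 K) K).mapMatrix MW).map
          (algebraMap K (w.adicCompletion K))) x y) = 1) ↔
      x ∈ stdLattice (w.adicCompletionIntegers K) :=
  forall_recordChar_kronecker_iff_mem_stdLattice K MV hV MW hW vp v w h ψ hψ hne h0 hstar x

omit [DecidableEq ι] [DecidableEq κ] in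
/-- **`ψ_w(gram K z z') = ψ(Tr_{K⁺_v/ℚ_p}(Tr_{K_w/K⁺_v}(gram K z z')))`** (the definition of `recordChar`). -/
theorem recordChar_gram_eq [StarRing (w.adicCompletion K)] (ψ : AddChar (vp.adicCompletion ℚ) Circle)
    (J : Matrix (ι × κ) (ι × κ) (w.adicCompletion K)) (z z' : ι × κ → w.adicCompletion K) :
    recordChar K vp v w ψ (gram J z z') =
      ψ (Algebra.trace (vp.adicCompletion ℚ) (v.adicCompletion (maximalRealSubfield K))
        (Algebra.trace (v.adicCompletion (maximalRealSubfield K)) (w.adicCompletion K) (gram J z z'))) := rfl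

end Record

section Symplectic

variable {F E : Type*} [Field F] [Field E] [Algebra F E] [StarRing E] [FiniteDimensional F E] [IsGalois F E]
  {ι κ : Type*} [Fintype ι] [Fintype κ]

/-- **THE SYMPLECTIC TRACE FORM IS THE TRACE OF THE SESQUILINEAR FORM**: for `star` the conjugation of a quadratic
Galois extension `E/F` (`[E : F] = 2`, `star` fixing `F`, `star ≠ id`), `Tr_{E/F}(gram K z z') = traceGram K z z'`
(file 94's `algebraMap_trace_eq_add_star`, file 90's `traceGram_apply`). -/
theorem algebraMap_trace_gram_eq_traceGram (h2 : Module.finrank F E = 2)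
    (hF : ∀ c : F, star (algebraMap F E c) = algebraMap F E c) (hnt : ∃ z : E, star z ≠ z)
    (K : Matrix (ι × κ) (ι × κ) E) (z z' : ι × κ → E) :
    algebraMap F E (Algebra.trace F E (gram K z z')) = traceGram K z z' := by
  rw [algebraMap_trace_eq_add_star h2 hF hnt, traceGram_apply]

end Symplectic

section SymplecticRecord

variable (K : Type*) [Field K] [NumberField K] {ι κ : Type*} [Fintype ι] [Fintype κ]
  (v : HeightOneSpectrum (𝓞 (maximalRealSubfield K))) (w : HeightOneSpectrum (𝓞 K))
  [w.asIdeal.LiesOver v.asIdeal] [StarRing (w.adicCompletion K)]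
  [FiniteDimensional (v.adicCompletion (maximalRealSubfield K)) (w.adicCompletion K)]
  [IsGalois (v.adicCompletion (maximalRealSubfield K)) (w.adicCompletion K)]

/-- **ON THE RECORD'S `K_w / K⁺_v` WITH `star = σ`, THE INNER TRACE OF `gram` IS FILE 90's `traceGram`**: the
character `ψ_w ∘ gram` of file 341 is `(ψ ∘ Tr_{K⁺_v/ℚ_p}) ∘ traceGram`, the character of the symplectic form
`Tr_{E/F}(h ⊗ s)` of the dual pair. -/
theorem algebraMap_trace_gram_eq_traceGram_adicCompletion
    (h2 : Module.finrank (v.adicCompletion (maximalRealSubfield K)) (w.adicCompletion K) = 2)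
    (hF : ∀ c : v.adicCompletion (maximalRealSubfield K),
      star (algebraMap (v.adicCompletion (maximalRealSubfield K)) (w.adicCompletion K) c) =
        algebraMap (v.adicCompletion (maximalRealSubfield K)) (w.adicCompletion K) c)
    (hnt : ∃ z : w.adicCompletion K, star z ≠ z) (J : Matrix (ι × κ) (ι × κ) (w.adicCompletion K))
    (z z' : ι × κ → w.adicCompletion K) :
    algebraMap (v.adicCompletion (maximalRealSubfield K)) (w.adicCompletion K)
        (Algebra.trace (v.adicCompletion (maximalRealSubfield K)) (w.adicCompletion K) (gram J z z')) =
      traceGram J z z' :=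
  algebraMap_trace_gram_eq_traceGram h2 hF hnt J z z'

end SymplecticRecord

end Summit.Ventures.HodgeRepro2.T5DualPairLatticeSymplectic
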